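import Literature.Computability.AlgebraicComplexity.BigCwSquarePieces
import Summits.MatrixMultiplication.MatrixMultiplication.Theorems.SaturationLadderLevelTwo
import HarnessLib

/-!
# Level 2 of the saturation ladder — the shared kit at `q = 6`
# (route `SaturationLadder`, node `TailDescentTwo`, lens 1, gen 22)

Cell `decomp-mm`, lens 1 («grading / quantitative ladder»), gen 22, file 1 of 5.  No named facts, no
sorry.  Design-independent pieces used by the level-2 rungs `ω(1,2,1) ≤ 101/31`
(`SaturationLadderLevelTwoK2Word`, `SaturationLadderLevelTwoK2`) and `ω(1,3,1) ≤ 80/19`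
(`SaturationLadderLevelTwoK3Word`, `SaturationLadderLevelTwoK3`), all over `CW_6^{⊗2}` over `ℂ`
(Le Gall 2012 §6.1 in the tree's format currency, `laserMethod_hasFormatValue_of_wordValue` on an
explicit valued word):

* the laser block `blockOf` of a word over the level-2 labels `PL5` and its format value for
  constant runs and concatenations (`blk`, `app`) — the `q = 6` twins of the `q = 5` helpers of
  `SaturationLadderLevelTwoWord` (gen 21), whose design-independent word and entropy helpers
  (`append_mem`, `repWord_mem`, `const_mem`, `fin5_lits`, `negMulLog_div'`,
  `log_two_mul_shannonEntropy_fin5`) are imported from there and from `SaturationLadderLevelTwo`;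
* the USED SUPPORT `supp14` of the designs — the level-2 support `cwSupport₂` without the letter
  `400` (`supp14_subset`, `eq_400_of_not_mem_supp14`);
* **zero rows do not change the penalty** (`sameMarginalsOn_eq_of_row_zero`,
  `maxEntropyPenalty_eq_of_row_zero`): if `S' ⊆ S` and the `x`-marginal of `P` vanishes on the rows
  of `S ∖ S'`, then `D_S(P) = D_{S'}(P)` (a law with those marginals is nonnegative with zero row
  sums there), hence `Γ_S(P) = Γ_{S'}(P)` — this is what lets a design omit the letter `400` and still
  have penalty `0` by the product-form criterion `maxEntropyPenalty_eq_zero_of_mul` on `supp14`;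
* the packing bound `R̃(CW_6^{⊗2}) ≤ 64` (`asymptoticRank_bigCwSq_six_le`).

## References

* F. Le Gall, *Faster algorithms for rectangular matrix multiplication*, FOCS 2012,
  arXiv:1204.1111, §3, §6.1, Prop. 6.2, Table 2. [LeGall2012]
* D. Coppersmith, S. Winograd, *Matrix multiplication via arithmetic progressions*,
  J. Symbolic Comput. 9 (1990), §8. [CoppersmithWinograd1990]
* D. Coppersmith, *Rectangular matrix multiplication revisited*, J. Complexity 13 (1997), §3.
  [Coppersmith1997]
* F. Le Gall, *Powers of tensors and fast matrix multiplication*, ISSAC 2014, arXiv:1401.7714,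
  Thm. 4.1 and Appendix A.3. [LeGall2014]
* V. Vassilevska Williams, Y. Xu, Z. Xu, R. Zhou, *New bounds for matrix multiplication: from
  alpha to omega*, SODA 2024, Table 1. [VassilevskaWilliamsXuXuZhou2024]
-/

set_option linter.dupNamespace false
set_option autoImplicit false
set_option exponentiation.threshold 100000
set_option maxRecDepth 100000

noncomputable section

open Finset Real
open scoped BigOperators

namespace Summit.MatrixMultiplication.MatrixMultiplication.Theorems.SaturationLadderLevelTwoKit

open Literature.Computability.AlgebraicComplexity
open Literature.Barriers.MatrixMultiplication (bigCwTensor)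
open SaturationLadderLevelTwo (append_mem repWord_mem const_mem fin5_lits negMulLog_div'
  log_two_mul_shannonEntropy_fin5)

/-! ## The level-2 labels -/

/-- The level-2 label set `{0,…,4}³`. [folklore] -/
abbrev PL5 := Fin 5 × Fin 5 × Fin 5

/-! ## Laser blocks over `CW_6^{⊗2}` -/

/-- The laser block of a word over the level-2 labels, for `CW_6^{⊗2}` over `ℂ`. [folklore] -/
abbrev blockOf {d : ℕ} (w : Fin d → PL5) :=
  laserBlock cwLev2 cwLev2 cwLev2 (bigCwSq ℂ 6) w

/-- A constant run of a component with format value `(1; A, B, C)` is worth `(1; Aⁿ, Bⁿ, Cⁿ)`.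
[folklore] -/
theorem blk (s : PL5) (n : ℕ) {A B C : ℝ}
    (h : HasFormatValue (cwSqComp ℂ 6 s.1 s.2.1 s.2.2) 1 A B C)
    (hA : 0 ≤ A := by positivity) (hB : 0 ≤ B := by positivity)
    (hC : 0 ≤ C := by positivity) :
    HasFormatValue (blockOf (fun _ : Fin n => s)) 1 (A ^ n) (B ^ n) (C ^ n) := by
  simpa using h.laserBlock_const cwLev2 cwLev2 cwLev2 (bigCwSq ℂ 6) zero_le_one hA hB hC n

/-- Concatenation multiplies format values (value `1`). [folklore] -/
theorem app {m n : ℕ} {w : Fin m → PL5} {w' : Fin n → PL5} {A B C A' B' C' : ℝ}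
    (h : HasFormatValue (blockOf w) 1 A B C) (h' : HasFormatValue (blockOf w') 1 A' B' C')
    (hA : 0 ≤ A := by positivity) (hA' : 0 ≤ A' := by positivity)
    (hB : 0 ≤ B := by positivity) (hB' : 0 ≤ B' := by positivity)
    (hC : 0 ≤ C := by positivity) (hC' : 0 ≤ C' := by positivity) :
    HasFormatValue (blockOf (Fin.append w w')) 1 (A * A') (B * B') (C * C') := by
  simpa using h.laserBlock_append cwLev2 cwLev2 cwLev2 (bigCwSq ℂ 6) h' zero_le_one zero_le_one
    hA hA' hB hB' hC hC'

/-! ## The used support -/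

/-- **The used support**: the fourteen letters of the design (the level-2 support without `400`).
[folklore] -/
def supp14 : Finset PL5 :=
  {((0 : Fin 5), (4 : Fin 5), (0 : Fin 5)), (0, 0, 4), (3, 1, 0), (1, 3, 0), (2, 2, 0), (3, 0, 1),
    (1, 0, 3), (2, 0, 2), (0, 3, 1), (0, 1, 3), (0, 2, 2), (1, 1, 2), (1, 2, 1), (2, 1, 1)}

/-- The used support is contained in the level-2 support. [folklore] -/
theorem supp14_subset : supp14 ⊆ cwSupport₂ := by
  decide

/-- The only unused letter of the level-2 support is `400`. [folklore] -/
theorem eq_400_of_not_mem_supp14 : ∀ x ∈ cwSupport₂, x ∉ supp14 → x = (4, 0, 0) := by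
  decide

/-! ## Zero rows do not change the penalty -/

/-- **A zero row is forced on the whole marginal class.**  If `S' ⊆ S` and the `x`-marginal of `P`
vanishes on the rows of the letters of `S ∖ S'`, then every law supported in `S` with the marginals
of `P` is supported in `S'` (it is nonnegative and its row sums there vanish): `D_S(P) = D_{S'}(P)`.
[folklore] -/
theorem sameMarginalsOn_eq_of_row_zero {S S' : Finset PL5} {P : PL5 → ℝ} (hS'S : S' ⊆ S)
    (hrow : ∀ x ∈ S, x ∉ S' → marginalDist₁ P x.1 = 0) :
    sameMarginalsOn S P = sameMarginalsOn S' P := by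
  ext Q
  simp only [mem_sameMarginalsOn]
  constructor
  · rintro ⟨hQ, hQS, h1, h2, h3⟩
    refine ⟨hQ, fun x hx => ?_, h1, h2, h3⟩
    by_cases hxS : x ∈ S
    · have hm : marginalDist₁ Q x.1 = 0 := by rw [h1]; exact hrow x hxS hx
      have hle : Q x ≤ marginalDist₁ Q x.1 := by
        obtain ⟨a, b, c⟩ := x
        show Q (a, b, c) ≤ ∑ b', ∑ c', Q (a, b', c')
        calc Q (a, b, c) ≤ ∑ c', Q (a, b, c') :=
              Finset.single_le_sum (f := fun c' => Q (a, b, c')) (fun c' _ => hQ.1 _)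
                (Finset.mem_univ c)
          _ ≤ ∑ b', ∑ c', Q (a, b', c') :=
              Finset.single_le_sum (f := fun b' => ∑ c', Q (a, b', c'))
                (fun b' _ => Finset.sum_nonneg fun c' _ => hQ.1 _) (Finset.mem_univ b)
      exact le_antisymm (hle.trans hm.le) (hQ.1 x)
    · exact hQS x hxS
  · rintro ⟨hQ, hQS', h1, h2, h3⟩
    exact ⟨hQ, fun x hx => hQS' x fun hx' => hx (hS'S hx'), h1, h2, h3⟩

/-- **Zero rows do not change the penalty**: `Γ_S(P) = Γ_{S'}(P)` under the hypotheses of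
`sameMarginalsOn_eq_of_row_zero`. [folklore] -/
theorem maxEntropyPenalty_eq_of_row_zero {S S' : Finset PL5} {P : PL5 → ℝ} (hS'S : S' ⊆ S)
    (hrow : ∀ x ∈ S, x ∉ S' → marginalDist₁ P x.1 = 0) :
    maxEntropyPenalty S P = maxEntropyPenalty S' P := by
  rw [maxEntropyPenalty, maxEntropyPenalty, maxEntropyGivenMarginals, maxEntropyGivenMarginals,
    sameMarginalsOn_eq_of_row_zero hS'S hrow]

/-! ## The packing bound -/

/-- `R̃(CW_6^{⊗2}) ≤ 64` (sub-multiplicativity and the border-rank bound `R̃(CW_q) ≤ q+2`).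
[cite: CoppersmithWinograd1990, §6 and §8] -/
theorem asymptoticRank_bigCwSq_six_le : asymptoticRank (bigCwSq ℂ 6) ≤ 64 := by
  have h := asymptoticRank_bigCwTensor_le ℂ 6
  have h0 := asymptoticRank_nonneg (bigCwTensor ℂ 6)
  calc asymptoticRank (bigCwSq ℂ 6)
      ≤ asymptoticRank (bigCwTensor ℂ 6) * asymptoticRank (bigCwTensor ℂ 6) :=
        asymptoticRank_kronecker_le _ _
    _ ≤ 8 * 8 :=
        mul_le_mul (by norm_num at h; linarith) (by norm_num at h; linarith) h0 (by norm_num)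
    _ = 64 := by norm_num

end Summit.MatrixMultiplication.MatrixMultiplication.Theorems.SaturationLadderLevelTwoKit

end
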